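import Summits.QuantumFields.YangMills.Theorems.AllWindowsColdBoxBoxHighLineSchurBlocks
import Summits.QuantumFields.YangMills.Theorems.AllWindowsColdBoxBoxHighLineSkinCoercivity

/-!
# LINE-19 S3b / LINE-20 U1 — STUB-PLAN-U1 §7.3 input (J′2): the skin Schur complement is coercive, `schurSkin ≥ 1`

The third of the four uniform block inputs of `RestBlock.landauKernelBounds_of_inputs` (file `…SchurBlocks`): for every skin vector `v`,
`Σ_s v_s² ≤ vᵀ·schurSkin·v`.  Proof: the Schur complement is the Hodge form at the optimal rest extension,
`vᵀ(A − C K⁻¹ Cᵀ)v = Vᵀ·hodgeQ·V` with `V = (v, −K⁻¹Cᵀv)` (`dotProduct_schurSkin_eq`), and the Hodge form dominates the skin square sum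
because every skin link (a link lying in a face, `exists_transverse_face_of_skin`) owns an outward plaquette of the enlarged block — the landed
(J′2) inequality `skin_sq_le_dotProduct_hodgeQ` (✓p728981, w5 g19).

Everything proved; standard axioms.  HONEST LABEL: bookkeeping toward stub S3 (⟨stmt-QuantumFields-24004⟩/⟨24335⟩; U1 of ⟨24336⟩); S3 is
NOT closed by this file ((h3) remains); no crux, rung or summit is proved; the Yang–Mills mass gap is NOT proved here.
-/

set_option autoImplicit false

noncomputable section

namespace Summit.QuantumFields.YangMills.Theorems.AllWindowsColdBoxBoxHighLine

open Finset Matrix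
open Literature.Probability.LatticeModels (Site)
open Literature.MathematicalPhysics.QuantumFieldTheory
open Literature.MathematicalPhysics.QuantumFieldTheory.LatticeMaxwell
open Literature.MathematicalPhysics.QuantumFieldTheory.AxialGauge
open Summit.QuantumFields.YangMills.Theorems.WeakCouplingRates
open Summit.QuantumFields.YangMills.Theorems.AllWindowsColdBox.BoxKernel

namespace RestBlock

variable {H : ℕ}

/-- **A skin link lies in a face TRANSVERSE to its direction** (`H ≥ 1`): some coordinate `ν ≠ μ` of its base point is `0` or `2H`. -/
theorem exists_transverse_face_of_skin (hH : 1 ≤ H) (s : Skin H) :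
    ∃ ν : Fin 4, ν ≠ s.1.1.1.2 ∧ (s.1.1.1.1 ν = 0 ∨ s.1.1.1.1 ν = 2 * (H : ℤ)) := by
  have hmem := free_mem_boxEdges s.1
  have hE : s.1.1.1 = (s.1.1.1.1, s.1.1.1.2) := rfl
  rw [hE, mem_boxEdges_iff] at hmem
  push_cast at hmem
  have hx : s.1.1.1.1 + Pi.single s.1.1.1.2 1 ∉ interiorSites H := fun hc => s.2 (Or.inr hc)
  have hx0 : s.1.1.1.1 ∉ interiorSites H := fun hc => s.2 (Or.inl hc)
  rw [mem_interiorSites_iff] at hx hx0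
  simp only [not_forall] at hx hx0
  obtain ⟨ν, hν⟩ := hx
  by_cases hνμ : ν = s.1.1.1.2
  · -- the upper endpoint fails in the longitudinal coordinate: impossible unless the lower endpoint fails transversally
    subst hνμ
    simp only [Pi.add_apply, Pi.single_eq_same] at hν
    obtain ⟨ν', hν'⟩ := hx0
    have hb := hmem.1 ν'
    have hl := hmem.2
    by_cases hν'μ : ν' = s.1.1.1.2
    · subst hν'μ; have hH' := hH; omega
    · exact ⟨ν', hν'μ, by omega⟩
  · have hb := hmem.1 ν
    simp only [Pi.add_apply, Pi.single_apply, hνμ, if_false, add_zero] at hν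
    exact ⟨ν, hνμ, by omega⟩

/-- **The Schur complement form is the Hodge form at the optimal rest extension**: with `p = Cᵀ v`,
`vᵀ·schurSkin·v = Vᵀ·hodgeQ·V` for `V = skinRest ∘ (v, −restInv p)`. -/
theorem dotProduct_schurSkin_eq (hH : 1 ≤ H) (v : Skin H → ℝ) :
    v ⬝ᵥ (schurSkin H *ᵥ v) =
      (fun e => Sum.elim v (-(restInv H *ᵥ ((coupling H)ᵀ *ᵥ v))) ((skinRest H).symm e)) ⬝ᵥ
        (hodgeQ H *ᵥ fun e => Sum.elim v (-(restInv H *ᵥ ((coupling H)ᵀ *ᵥ v))) ((skinRest H).symm e)) := by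
  haveI : NeZero H := ⟨by omega⟩
  set p : Rest H → ℝ := (coupling H)ᵀ *ᵥ v with hp
  set w : Rest H → ℝ := -(restInv H *ᵥ p) with hw
  set U : Skin H ⊕ Rest H → ℝ := Sum.elim v w with hU
  -- pull the Hodge form back to the block matrix
  have hQ : (fun e => U ((skinRest H).symm e)) ⬝ᵥ (hodgeQ H *ᵥ fun e => U ((skinRest H).symm e)) =
      U ⬝ᵥ (Matrix.reindex (skinRest H).symm (skinRest H).symm (hodgeQ H) *ᵥ U) := by
    simp only [dotProduct, Matrix.mulVec, Matrix.reindex_apply, Matrix.submatrix_apply, Equiv.symm_symm]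
    rw [← Equiv.sum_comp (skinRest H)]
    refine Finset.sum_congr rfl fun a _ => ?_
    rw [Equiv.symm_apply_apply, ← Equiv.sum_comp (skinRest H)]
    simp only [Equiv.symm_apply_apply]
  rw [hQ, hodgeQ_reindex_eq_fromBlocks, hU, Matrix.fromBlocks_mulVec, sumElim_dotProduct_sumElim,
    Sum.elim_comp_inl, Sum.elim_comp_inr]
  -- block algebra
  have h1 : v ⬝ᵥ (coupling H *ᵥ w) = -(p ⬝ᵥ (restInv H *ᵥ p)) := by
    rw [hw, Matrix.mulVec_neg, dotProduct_neg, Matrix.dotProduct_mulVec, ← Matrix.mulVec_transpose]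
  have h2 : w ⬝ᵥ p = -(p ⬝ᵥ (restInv H *ᵥ p)) := by
    rw [hw, neg_dotProduct, dotProduct_comm]
  have h3 : w ⬝ᵥ (restBlock H *ᵥ w) = p ⬝ᵥ (restInv H *ᵥ p) := by
    rw [hw, Matrix.mulVec_neg, dotProduct_neg, neg_dotProduct, neg_neg, Matrix.mulVec_mulVec p (restBlock H) (restInv H),
      restBlock_mul_restInv, Matrix.one_mulVec, dotProduct_comm]
  have h4 : v ⬝ᵥ (schurSkin H *ᵥ v) = v ⬝ᵥ (skinBlock H *ᵥ v) - p ⬝ᵥ (restInv H *ᵥ p) := by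
    rw [schurSkin, Matrix.sub_mulVec, dotProduct_sub, ← Matrix.mulVec_mulVec, ← Matrix.mulVec_mulVec, ← hp,
      Matrix.dotProduct_mulVec v (coupling H), ← Matrix.mulVec_transpose, ← hp]
  have h5 : (coupling H)ᵀ *ᵥ v = p := hp.symm
  rw [h4, dotProduct_add, dotProduct_add, h1, h3, h5, h2]
  ring

/-- **(J′2): the skin Schur complement is coercive**, `Σ_s v_s² ≤ vᵀ·schurSkin·v`, uniformly in `H`. -/
theorem schurSkin_coercive : ∀ H : ℕ, 1 ≤ H → ∀ v : Skin H → ℝ, 1 * ∑ s, v s ^ 2 ≤ v ⬝ᵥ (schurSkin H *ᵥ v) := by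
  intro H hH v
  rw [one_mul, dotProduct_schurSkin_eq hH v]
  set V : LandauFree H → ℝ := fun e => Sum.elim v (-(restInv H *ᵥ ((coupling H)ᵀ *ᵥ v))) ((skinRest H).symm e) with hV
  have hS : ∀ e ∈ (Finset.univ : Finset (Skin H)).map (Function.Embedding.subtype _), ∃ ν : Fin 4, ν ≠ e.1.1.2 ∧
      (e.1.1.1 ν = 0 ∨ e.1.1.1 ν = 2 * (H : ℤ)) := by
    intro e he
    rw [Finset.mem_map] at he
    obtain ⟨s, -, rfl⟩ := he
    exact exists_transverse_face_of_skin hH s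
  have h := skin_sq_le_dotProduct_hodgeQ H V _ hS
  rw [Finset.sum_map] at h
  have hVs : ∀ s : Skin H, V (Function.Embedding.subtype _ s) = v s := by
    intro s
    have : (skinRest H).symm s.1 = Sum.inl s := by
      rw [Equiv.symm_apply_eq]; rfl
    simp only [hV, Function.Embedding.coe_subtype, this, Sum.elim_inl]
  simp only [hVs] at h
  exact h

end RestBlock

end Summit.QuantumFields.YangMills.Theorems.AllWindowsColdBoxBoxHighLine

end
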